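import Summits.ResolutionOfSingularities.ResolutionOfSingularities.Theorems.FrobeniusLadderFRationalResolutionOrbitSeparation
import Summits.ResolutionOfSingularities.ResolutionOfSingularities.Theorems.FrobeniusLadderFRationalResolutionFanStepAvoidsRegular
import HarnessLib

/-!
# Crux `FrobeniusLadder.FRationalResolution` (stmt-ResolutionOfSingularities-15317), line `redirect`,
# stub `stub_diagonalizableQuotientResolution` — the SYNCHRONISED EQUIVARIANT STEP of the ladder (lane W‴, L2′)

Continuation of `…OrbitSeparation` (✓ p831037). Setting: the isolated simplicial cone `σ = hull S₀` (all proper subfamilies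
of `S₀` regular), a finite set `G` of lattice automorphisms of `ℚ^κ` closed under inverses and composition, permuting `S₀`;
a primitively simplicial fan `Δ` with every cone `≤ σ`, `σ ∉ Δ.cones`, `G`-stable, and carrying the **interior-ray
invariant** (`t ∈ K ∖ S₀`, `g t ∈ K` ⇒ `g t = t` on the primitive generators `K` of every cone). For a parallelotope point
`w = Σ a_t t` of a cone of `Δ` we subdivide `Δ` simultaneously at the whole orbit `G w` ([KempfEtAl1973] Ch. II §2:
"at all images of the point at once"; tree `Fan.starIter`, `Fan.mem_starIter_cones_iff_of_separated`) and show that the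
whole invariant package survives:

* `orbit_separated` — no cone of `Δ` contains two distinct orbit points (from the orbit separation lemma);
* `orbit_point` — each `g w` is a parallelotope point of the cone `g ρ ∈ Δ.cones` with the same count, primitive if `w` is;
* `map_mem_starIter_orbit` — the subdivided fan is again `G`-stable;
* `fix_starIter_orbit` — the subdivided fan again carries the interior-ray invariant;
* `hull_notMem_starIter`, `le_hull_of_mem_starIter`, `mem_starIter_orbit_of_isRegularGens` — `σ` is still not a cone,
  all cones stay inside `σ`, and every REGULAR cone of `Δ` (in particular every proper face of `σ`) survives.

Honest label: fan combinatorics for the DESIGN W‴ (the step of the equivariant ladder; the round-0 corner star and the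
termination loop `Fan.exists_regular_starIter_of_invariant` are NOT in this file). No stub closed by name. No definitions,
no named facts, no sorry. [cite: KempfEtAl1973, Ch. II §2] [cite: Fulton1993Toric, §2.6 p. 48]
-/

-- single-problem summit: the doubled namespace component is forced
set_option linter.dupNamespace false

namespace Summit.ResolutionOfSingularities.ResolutionOfSingularities.Theorems.FRationalResolution.EquivariantStep

open Literature.Geometry.PolyhedralFans PointedCone Finset
open Summit.ResolutionOfSingularities.ResolutionOfSingularities.Theorems.FRationalResolution.OrbitSeparation

variable {κ : Type*} [Fintype κ]

omit [Fintype κ] in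
/-- Membership in the image of a cone under a linear automorphism: `x ∈ g ρ ↔ g⁻¹ x ∈ ρ`. [folklore] -/
theorem mem_map_iff_symm_mem (g : (κ → ℚ) ≃ₗ[ℚ] (κ → ℚ)) (ρ : PointedCone ℚ (κ → ℚ)) (x : κ → ℚ) :
    x ∈ ρ.map (g : (κ → ℚ) →ₗ[ℚ] (κ → ℚ)) ↔ g.symm x ∈ ρ := by
  rw [PointedCone.mem_map]
  constructor
  · rintro ⟨y, hy, rfl⟩
    simpa using hy
  · intro hx
    exact ⟨g.symm x, hx, by simp⟩

omit [Fintype κ] in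
/-- The image of a cone under `g` followed by `h` is the image under `g.trans h`. [folklore] -/
theorem map_map_trans (g h : (κ → ℚ) ≃ₗ[ℚ] (κ → ℚ)) (ρ : PointedCone ℚ (κ → ℚ)) :
    (ρ.map (g : (κ → ℚ) →ₗ[ℚ] (κ → ℚ))).map (h : (κ → ℚ) →ₗ[ℚ] (κ → ℚ)) =
      ρ.map ((g.trans h : (κ → ℚ) ≃ₗ[ℚ] (κ → ℚ)) : (κ → ℚ) →ₗ[ℚ] (κ → ℚ)) := by
  rw [PointedCone.map_map]
  rfl

omit [Fintype κ] in
/-- **Each orbit point is a parallelotope point of the transported cone, with the same count.** For a lattice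
automorphism `g` (both directions) and a cone `ρ` with primitive simplicial generators `T` and `a ∈ parCoeffs T`:
`g '' T` are primitive simplicial generators of `g ρ`, `a ∘ g⁻¹ ∈ parCoeffs (g '' T)` represents `g w`, the counts of
`g ρ` and `ρ` agree, and `g w` is primitive when `w` is. [cite: KempfEtAl1973, Ch. II §2] -/
theorem orbit_point [DecidableEq (κ → ℚ)] (g : (κ → ℚ) ≃ₗ[ℚ] (κ → ℚ))
    (hgN : ∀ x ∈ latticeN κ, g x ∈ latticeN κ) (hgN' : ∀ x ∈ latticeN κ, g.symm x ∈ latticeN κ)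
    {ρ : PointedCone ℚ (κ → ℚ)} {T : Finset (κ → ℚ)} (hT : IsPrimGens ρ T) {a : (κ → ℚ) → ℚ}
    (ha : a ∈ parCoeffs T) :
    IsPrimGens (ρ.map (g : (κ → ℚ) →ₗ[ℚ] (κ → ℚ))) (T.image g) ∧
      (fun u => a (g.symm u)) ∈ parCoeffs (T.image g) ∧
      ∑ u ∈ T.image g, a (g.symm u) • u = g (∑ t ∈ T, a t • t) ∧
      conePMult (ρ.map (g : (κ → ℚ) →ₗ[ℚ] (κ → ℚ))) = conePMult ρ ∧
      (IsPrimitive (∑ t ∈ T, a t • t) → IsPrimitive (g (∑ t ∈ T, a t • t))) := by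
  have hinj : ∀ x ∈ (⊤ : Submodule ℚ (κ → ℚ)), (g : (κ → ℚ) →ₗ[ℚ] (κ → ℚ)) x = 0 → x = 0 :=
    fun x _ hx => by simpa using hx
  have hlat : ∀ x ∈ (⊤ : Submodule ℚ (κ → ℚ)), x ∈ latticeN κ → (g : (κ → ℚ) →ₗ[ℚ] (κ → ℚ)) x ∈ latticeN κ :=
    fun x _ hx => by simpa using hgN x hx
  have hlat' : ∀ y ∈ latticeN κ, y ∈ (⊤ : Submodule ℚ (κ → ℚ)).map (g : (κ → ℚ) →ₗ[ℚ] (κ → ℚ)) →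
      ∃ x ∈ (⊤ : Submodule ℚ (κ → ℚ)), x ∈ latticeN κ ∧ (g : (κ → ℚ) →ₗ[ℚ] (κ → ℚ)) x = y :=
    fun y hy _ => ⟨g.symm y, Submodule.mem_top, hgN' y hy, by simp⟩
  have htop : ((ρ : Set (κ → ℚ))) ⊆ (⊤ : Submodule ℚ (κ → ℚ)) := fun _ _ => Submodule.mem_top
  have hgT : IsPrimGens (ρ.map (g : (κ → ℚ) →ₗ[ℚ] (κ → ℚ))) (T.image (g : (κ → ℚ) →ₗ[ℚ] (κ → ℚ))) :=
    isPrimGens_map hinj hlat hlat' htop hT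
  have himg : T.image (g : (κ → ℚ) →ₗ[ℚ] (κ → ℚ)) = T.image g := Finset.image_congr fun x _ => by simp
  rw [himg] at hgT
  have hzN : g (∑ t ∈ T, a t • t) ∈ latticeN κ := hgN _ ha.2.2
  refine ⟨hgT, parCoeffs_image_symm g ha hzN, sum_image_symm_eq_map g T a, ?_, fun hw => ?_⟩
  · exact conePMult_map hinj hlat hlat' htop hT
  · simpa using isPrimitive_map hinj hlat hlat' (x := ∑ t ∈ T, a t • t) Submodule.mem_top hw

/-- **The orbit of a parallelotope point is separated.** In the setting of the orbit separation lemma, with `G` a set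
of lattice automorphisms closed under inverses and composition (each permuting `S₀`, carrying cones of `Δ` to cones of
`Δ`, satisfying the interior-ray invariant), no cone of `Δ` contains two distinct points `g₁ w ≠ g₂ w` of the orbit of a
parallelotope point `w`. [cite: KempfEtAl1973, Ch. II §2] -/
theorem orbit_separated {Δ : Fan ℚ (κ → ℚ)} (hΔ : Δ.IsPrimSimplicial)
    {S₀ : Finset (κ → ℚ)} (hle : ∀ ρ ∈ Δ.cones, ρ ≤ PointedCone.hull ℚ (S₀ : Set (κ → ℚ)))
    (hσ : PointedCone.hull ℚ (S₀ : Set (κ → ℚ)) ∉ Δ.cones) (hiso : ∀ J : Finset (κ → ℚ), J ⊂ S₀ → IsRegularGens J)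
    {G : Set ((κ → ℚ) ≃ₗ[ℚ] (κ → ℚ))} (hGN : ∀ g ∈ G, ∀ x ∈ latticeN κ, g x ∈ latticeN κ)
    (hGsymm : ∀ g ∈ G, g.symm ∈ G) (hGtrans : ∀ g ∈ G, ∀ h ∈ G, g.trans h ∈ G)
    (hGS₀ : ∀ g ∈ G, ∀ s ∈ S₀, g s ∈ S₀)
    (hGΔ : ∀ g ∈ G, ∀ ρ ∈ Δ.cones, ρ.map (g : (κ → ℚ) →ₗ[ℚ] (κ → ℚ)) ∈ Δ.cones)
    (hfix : ∀ g ∈ G, ∀ κ' ∈ Δ.cones, ∀ K : Finset (κ → ℚ), IsPrimGens κ' K →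
      ∀ t ∈ K, t ∉ S₀ → g t ∈ K → g t = t)
    {ρ : PointedCone ℚ (κ → ℚ)} (hρ : ρ ∈ Δ.cones) {T : Finset (κ → ℚ)} (hT : IsPrimGens ρ T)
    {a : (κ → ℚ) → ℚ} (ha : a ∈ parCoeffs T)
    {κ' : PointedCone ℚ (κ → ℚ)} (hκ' : κ' ∈ Δ.cones) {g₁ g₂ : (κ → ℚ) ≃ₗ[ℚ] (κ → ℚ)} (hg₁ : g₁ ∈ G)
    (hg₂ : g₂ ∈ G) (h₁ : g₁ (∑ t ∈ T, a t • t) ∈ κ') (h₂ : g₂ (∑ t ∈ T, a t • t) ∈ κ') :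
    g₁ (∑ t ∈ T, a t • t) = g₂ (∑ t ∈ T, a t • t) := by
  classical
  -- `g₁ w` is a parallelotope point of `g₁ ρ`; apply the separation lemma to `g = g₂ ∘ g₁⁻¹`
  obtain ⟨hT₁, ha₁, hsum₁, -, -⟩ := orbit_point g₁ (hGN g₁ hg₁) (hGN _ (hGsymm g₁ hg₁)) hT ha
  set g := g₁.symm.trans g₂ with hgdef
  have hg : g ∈ G := hGtrans _ (hGsymm g₁ hg₁) _ hg₂
  have hgz : g (g₁ (∑ t ∈ T, a t • t)) = g₂ (∑ t ∈ T, a t • t) := by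
    simp [hgdef]
  have key := map_eq_self_of_mem_of_map_mem hΔ hle hσ hiso g (hGN g hg) (hGN _ (hGsymm g hg)) (hGS₀ g hg)
    (hGΔ g hg) (hfix g hg) (hGΔ g₁ hg₁ ρ hρ) hκ' hT₁ ha₁ (by rw [hsum₁]; exact h₁)
    (by rw [hsum₁, hgz]; exact h₂)
  rw [hsum₁, hgz] at key
  exact key.symm

omit [Fintype κ] in
/-- **A new cone of a star subdivision has primitive generators `insert z T`.** If `τ` (generators `T`) and `σ' ≥ τ` are
cones of a fan, `z ∈ σ'` primitive with `z ∉ τ`, then `insert z T` is the primitive simplicial generating set of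
`τ + ℚ_{≥0} z`. (The argument of `Fan.exists_step`.) [cite: Fulton1993Toric, §2.6 p. 48] -/
theorem isPrimGens_sup_ray [DecidableEq (κ → ℚ)] {Δ : Fan ℚ (κ → ℚ)} {τ σ' : PointedCone ℚ (κ → ℚ)}
    (hτ : τ ∈ Δ.cones) (hσ' : σ' ∈ Δ.cones) (hτσ' : τ ≤ σ') {T : Finset (κ → ℚ)} (hT : IsPrimGens τ T)
    {z : κ → ℚ} (hz : IsPrimitive z) (hzσ' : z ∈ σ') (hzτ : z ∉ τ) :
    IsPrimGens (τ ⊔ ray ℚ z) (insert z T) := by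
  refine ⟨?_, ?_, ?_⟩
  · intro s hs
    rcases Finset.mem_insert.mp hs with rfl | hs
    · exact hz
    · exact hT.1 s hs
  · rw [Finset.coe_insert]
    refine hT.2.1.id_insert fun hwspan => hzτ ?_
    have hface : τ.IsFaceOf σ' := Fan.isFaceOf_of_le hσ' hτ hτσ'
    refine mem_of_isFaceOf_of_mem_span hface hzσ' ?_
    rwa [hT.2.2, span_coe_hull]
  · rw [Finset.coe_insert, hull_insert, ← hT.2.2]

section Step

variable {Δ : Fan ℚ (κ → ℚ)} {S₀ : Finset (κ → ℚ)} {G : Set ((κ → ℚ) ≃ₗ[ℚ] (κ → ℚ))}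
  {ρ : PointedCone ℚ (κ → ℚ)} {T : Finset (κ → ℚ)} {a : (κ → ℚ) → ℚ} {l : List (κ → ℚ)}

/-- **The orbit list is separated by `Δ`** (list form of `orbit_separated`, the hypothesis `hsep` of the tree's
synchronised-step lemmas). [cite: KempfEtAl1973, Ch. II §2] -/
theorem orbitList_separated (hΔ : Δ.IsPrimSimplicial)
    (hle : ∀ ρ ∈ Δ.cones, ρ ≤ PointedCone.hull ℚ (S₀ : Set (κ → ℚ)))
    (hσ : PointedCone.hull ℚ (S₀ : Set (κ → ℚ)) ∉ Δ.cones) (hiso : ∀ J : Finset (κ → ℚ), J ⊂ S₀ → IsRegularGens J)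
    (hGN : ∀ g ∈ G, ∀ x ∈ latticeN κ, g x ∈ latticeN κ)
    (hGsymm : ∀ g ∈ G, g.symm ∈ G) (hGtrans : ∀ g ∈ G, ∀ h ∈ G, g.trans h ∈ G)
    (hGS₀ : ∀ g ∈ G, ∀ s ∈ S₀, g s ∈ S₀)
    (hGΔ : ∀ g ∈ G, ∀ ρ ∈ Δ.cones, ρ.map (g : (κ → ℚ) →ₗ[ℚ] (κ → ℚ)) ∈ Δ.cones)
    (hfix : ∀ g ∈ G, ∀ κ' ∈ Δ.cones, ∀ K : Finset (κ → ℚ), IsPrimGens κ' K →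
      ∀ t ∈ K, t ∉ S₀ → g t ∈ K → g t = t)
    (hρ : ρ ∈ Δ.cones) (hT : IsPrimGens ρ T) (ha : a ∈ parCoeffs T)
    (hl : ∀ z ∈ l, ∃ g ∈ G, z = g (∑ t ∈ T, a t • t)) :
    ∀ σ' ∈ Δ.cones, ∀ z ∈ l, ∀ z' ∈ l, z ∈ σ' → z' ∈ σ' → z = z' := by
  intro σ' hσ' z hz z' hz' hzσ hz'σ
  obtain ⟨g₁, hg₁, rfl⟩ := hl z hz
  obtain ⟨g₂, hg₂, rfl⟩ := hl z' hz'
  exact orbit_separated hΔ hle hσ hiso hGN hGsymm hGtrans hGS₀ hGΔ hfix hρ hT ha hσ' hg₁ hg₂ hzσ hz'σ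

omit [Fintype κ] in
/-- **`G`-stability survives the synchronised step.** If `Δ` is `G`-stable and `l` is a duplicate-free `G`-closed list
separated by `Δ`, then `g` carries every cone of `Δ.starIter l` to a cone of `Δ.starIter l`: old cones avoiding the
points go to old cones avoiding the points, and `τ + ℚ_{≥0} z ↦ g τ + ℚ_{≥0} (g z)`.
[cite: KempfEtAl1973, Ch. II §2] [cite: Fulton1993Toric, §2.6 p. 47] -/
theorem map_mem_starIter_of_closed (hGsymm : ∀ g ∈ G, g.symm ∈ G)
    (hGΔ : ∀ g ∈ G, ∀ ρ ∈ Δ.cones, ρ.map (g : (κ → ℚ) →ₗ[ℚ] (κ → ℚ)) ∈ Δ.cones)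
    (hnd : l.Nodup) (hlG : ∀ g ∈ G, ∀ z ∈ l, g z ∈ l)
    (hsep : ∀ σ' ∈ Δ.cones, ∀ z ∈ l, ∀ z' ∈ l, z ∈ σ' → z' ∈ σ' → z = z')
    {g : (κ → ℚ) ≃ₗ[ℚ] (κ → ℚ)} (hg : g ∈ G) {ρ' : PointedCone ℚ (κ → ℚ)} (hρ' : ρ' ∈ (Δ.starIter l).cones) :
    ρ'.map (g : (κ → ℚ) →ₗ[ℚ] (κ → ℚ)) ∈ (Δ.starIter l).cones := by
  rw [Fan.mem_starIter_cones_iff_of_separated l hnd hsep] at hρ' ⊢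
  rcases hρ' with ⟨hρ'Δ, hlρ'⟩ | ⟨z, hz, τ, hτ, hzτ, ⟨σ', hσ', hτσ', hzσ'⟩, rfl⟩
  · refine Or.inl ⟨hGΔ g hg ρ' hρ'Δ, fun z hz hzρ => ?_⟩
    rw [mem_map_iff_symm_mem] at hzρ
    exact hlρ' _ (hlG _ (hGsymm g hg) z hz) hzρ
  · refine Or.inr ⟨g z, hlG g hg z hz, τ.map (g : (κ → ℚ) →ₗ[ℚ] (κ → ℚ)), hGΔ g hg τ hτ, ?_,
      ⟨σ'.map (g : (κ → ℚ) →ₗ[ℚ] (κ → ℚ)), hGΔ g hg σ' hσ', map_mono' _ hτσ', ?_⟩, ?_⟩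
    · rw [mem_map_iff_symm_mem, g.symm_apply_apply]; exact hzτ
    · rw [mem_map_iff_symm_mem, g.symm_apply_apply]; exact hzσ'
    · rw [map_sup_ray]; rfl

omit [Fintype κ] in
/-- **The interior-ray invariant survives the synchronised step.** With `l` a duplicate-free `G`-closed list of PRIMITIVE
vectors separated by `Δ`: on the primitive generators `K` of any cone of `Δ.starIter l`, `t ∈ K ∖ S₀` and `g t ∈ K`
force `g t = t`. (A new generator `z ∈ l` of `τ + ℚ_{≥0} z` with `g z` among the generators: `g z ∈ l` lies with `z` in
the old cone `σ' ≥ τ + ℚ_{≥0} z`, so `g z = z` by separation; an old generator `t` with `g t = z` is itself in `l` and in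
`σ'`, so `t = z`.) [cite: KempfEtAl1973, Ch. II §2] -/
theorem fix_starIter_of_closed [DecidableEq (κ → ℚ)] (hΔ : Δ.IsPrimSimplicial) (hGsymm : ∀ g ∈ G, g.symm ∈ G)
    (hfix : ∀ g ∈ G, ∀ κ' ∈ Δ.cones, ∀ K : Finset (κ → ℚ), IsPrimGens κ' K →
      ∀ t ∈ K, t ∉ S₀ → g t ∈ K → g t = t)
    (hnd : l.Nodup) (hlG : ∀ g ∈ G, ∀ z ∈ l, g z ∈ l) (hprim : ∀ z ∈ l, IsPrimitive z)
    (hsep : ∀ σ' ∈ Δ.cones, ∀ z ∈ l, ∀ z' ∈ l, z ∈ σ' → z' ∈ σ' → z = z')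
    {g : (κ → ℚ) ≃ₗ[ℚ] (κ → ℚ)} (hg : g ∈ G) {κ' : PointedCone ℚ (κ → ℚ)} (hκ' : κ' ∈ (Δ.starIter l).cones)
    {K : Finset (κ → ℚ)} (hK : IsPrimGens κ' K) {t : κ → ℚ} (ht : t ∈ K) (htS : t ∉ S₀) (hgt : g t ∈ K) :
    g t = t := by
  rw [Fan.mem_starIter_cones_iff_of_separated l hnd hsep] at hκ'
  rcases hκ' with ⟨hκ'Δ, -⟩ | ⟨z, hz, τ, hτ, hzτ, ⟨σ', hσ', hτσ', hzσ'⟩, rfl⟩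
  · exact hfix g hg κ' hκ'Δ K hK t ht htS hgt
  · obtain ⟨Tτ, hTτ⟩ := hΔ.exists_isPrimGens hτ
    have hnew : IsPrimGens (τ ⊔ ray ℚ z) (insert z Tτ) :=
      isPrimGens_sup_ray hτ hσ' hτσ' hTτ (hprim z hz) hzσ' hzτ
    have hKeq : K = insert z Tτ := hK.unique hnew
    rw [hKeq] at ht hgt
    have hTτsub : ∀ u ∈ Tτ, u ∈ σ' := fun u hu =>
      hτσ' (hTτ.2.2 ▸ PointedCone.subset_hull (Finset.mem_coe.mpr hu))
    rcases Finset.mem_insert.mp ht with rfl | htT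
    · -- `t = z`: either `g z = z`, or `g z` is an old generator in `σ'`, with `z ∈ σ'`
      rcases Finset.mem_insert.mp hgt with h | hgT
      · exact h
      · exact (hsep σ' hσ' t hz (g t) (hlG g hg t hz) hzσ' (hTτsub _ hgT)).symm
    · rcases Finset.mem_insert.mp hgt with h | hgT
      · -- `g t = z`: then `t = g⁻¹ z ∈ l` lies in `τ ≤ σ'` together with `z`
        have htl : t ∈ l := by
          have := hlG _ (hGsymm g hg) z hz
          rwa [← h, g.symm_apply_apply] at this
        have htz : t = z := hsep σ' hσ' t htl z hz (hTτsub t htT) hzσ'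
        rw [h, htz]
      · exact hfix g hg τ hτ Tτ hTτ t htT htS hgT

omit [Fintype κ] in
/-- `σ = hull S₀` is still not a cone after further star subdivisions (every new cone lies in an old one).
[cite: Fulton1993Toric, §2.6 p. 47] -/
theorem hull_notMem_starIter (hle : ∀ ρ ∈ Δ.cones, ρ ≤ PointedCone.hull ℚ (S₀ : Set (κ → ℚ)))
    (hσ : PointedCone.hull ℚ (S₀ : Set (κ → ℚ)) ∉ Δ.cones) (l : List (κ → ℚ)) :
    PointedCone.hull ℚ (S₀ : Set (κ → ℚ)) ∉ (Δ.starIter l).cones := by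
  intro h
  obtain ⟨σ', hσ', hle'⟩ := Fan.starIter_exists_le l h
  have heq : σ' = PointedCone.hull ℚ (S₀ : Set (κ → ℚ)) := le_antisymm (hle σ' hσ') hle'
  exact hσ (heq ▸ hσ')

omit [Fintype κ] in
/-- All cones stay inside `σ = hull S₀` after further star subdivisions. [cite: Fulton1993Toric, §2.6 p. 47] -/
theorem le_hull_of_mem_starIter (hle : ∀ ρ ∈ Δ.cones, ρ ≤ PointedCone.hull ℚ (S₀ : Set (κ → ℚ)))
    (l : List (κ → ℚ)) {ρ' : PointedCone ℚ (κ → ℚ)} (hρ' : ρ' ∈ (Δ.starIter l).cones) :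
    ρ' ≤ PointedCone.hull ℚ (S₀ : Set (κ → ℚ)) := by
  obtain ⟨σ', hσ', hle'⟩ := Fan.starIter_exists_le l hρ'
  exact hle'.trans (hle σ' hσ')

/-- **Regular cones survive the synchronised step** (in particular the proper faces of the isolated cone): an orbit
point `g w ≠ 0` is a parallelotope point of the cone `g ρ` of `Δ`, hence lies in no regular cone of `Δ`
(`sum_smul_notMem_of_isRegularGens_of_parCoeffs`), so a regular cone of `Δ` is a cone of `Δ.starIter l` avoiding all
points of `l`. [cite: Fulton1993Toric, §2.6 p. 48] -/
theorem mem_starIter_orbit_of_isRegularGens [DecidableEq κ]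
    (hGN : ∀ g ∈ G, ∀ x ∈ latticeN κ, g x ∈ latticeN κ) (hGsymm : ∀ g ∈ G, g.symm ∈ G)
    (hGΔ : ∀ g ∈ G, ∀ ρ ∈ Δ.cones, ρ.map (g : (κ → ℚ) →ₗ[ℚ] (κ → ℚ)) ∈ Δ.cones)
    (hρ : ρ ∈ Δ.cones) (hT : IsPrimGens ρ T) (ha : a ∈ parCoeffs T) (hw0 : ∑ t ∈ T, a t • t ≠ 0)
    (hnd : l.Nodup) (hl : ∀ z ∈ l, ∃ g ∈ G, z = g (∑ t ∈ T, a t • t))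
    (hsep : ∀ σ' ∈ Δ.cones, ∀ z ∈ l, ∀ z' ∈ l, z ∈ σ' → z' ∈ σ' → z = z')
    {τ : PointedCone ℚ (κ → ℚ)} (hτ : τ ∈ Δ.cones) {Tτ : Finset (κ → ℚ)} (hTτ : IsPrimGens τ Tτ)
    (hreg : IsRegularGens Tτ) :
    τ ∈ (Δ.starIter l).cones ∧ ∀ z ∈ l, z ∉ τ := by
  classical
  have havoid : ∀ z ∈ l, z ∉ τ := by
    intro z hz
    obtain ⟨g, hg, rfl⟩ := hl z hz
    obtain ⟨hT₁, ha₁, hsum₁, -, -⟩ := orbit_point g (hGN g hg) (hGN _ (hGsymm g hg)) hT ha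
    rw [← hsum₁]
    refine sum_smul_notMem_of_isRegularGens_of_parCoeffs (hGΔ g hg ρ hρ) hτ hT₁ hTτ hreg ha₁ ?_
    rw [hsum₁]
    intro h0
    exact hw0 (by simpa using congrArg g.symm h0)
  refine ⟨?_, havoid⟩
  rw [Fan.mem_starIter_cones_iff_of_separated l hnd hsep]
  exact Or.inl ⟨hτ, havoid⟩

end Step

end Summit.ResolutionOfSingularities.ResolutionOfSingularities.Theorems.FRationalResolution.EquivariantStep
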